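import Literature.NumberTheory.EllipticCurves.SelmerCorankProofs
import Summits.BirchSwinnertonDyer.Rank1Residual.LW16.IsogenyKummerDegeneration
import HarnessLib

/-!
# The `p`-isogeny edge dichotomy in the binders' currency: `F`-rational points and `p ∤ [E(F) : ℤP]`

Companion of `LW16/IsogenyKummerDegeneration.lean` (p465503). There the dichotomy
`exists_root_xor_generates_of_not_dvd_index` is stated for points of the `Γ_F`-fixed subgroup
`E(F̄)^{Γ_F}` of `geomPoints W`. The tree's Kolyvagin binders
(`LawsonWuthrich2016.thm14_padicValNat_shaOrder_le_general`, the GAP-target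
`LW16.KolyvaginCertificateReducible`, …) carry their Heegner point as an `F`-RATIONAL point
`P : (W.baseChange F).toAffine.Point` with the certificate `¬ p ∣ (AddSubgroup.zmultiples P).index`
and `¬ IsOfFinAddOrder P`. This file transports the two hypotheses along the tree's embedding
`toGeomPoints W : W.toAffine.Point →+ geomPoints W` (injective, image = the `Γ_F`-fixed points for
`F` perfect: `toGeomPoints_injective`, `smul_toGeomPoints`,
`exists_toGeomPoints_eq_of_forall_smul_eq`, file `SelmerCorankProofs`) and restates the dichotomy
with `F`-rational data: for isogenies `φ : E → E'`, `ψ : E' → E` over a perfect field `F` with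
`ψ ∘ φ = [p]`, a point `P ∈ E(F)` of infinite order with `p ∤ [E(F) : ℤP]`, and `P' ∈ E'(F)` with
`p ∤ [E'(F) : ℤP']`, EXACTLY ONE of: (A) `P` has a `p`-th root `Q ∈ E(F̄)` with `σQ − Q ∈ ker φ`
for all `σ ∈ Γ_F` (the Kummer extension of `P` degenerates inside `ker φ`: the conclusion of
Gross 1991 Prop. 9.3 fails for `S = ⟨δP⟩`); (B) `E'(F) = ℤφ(P) + pE'(F)`.
Theorems only; no `def`, no named fact; nothing here proves BSD for any pair. Typer seat
`bsd-litref-lw16-ty` (cell `bsd-litref/lw16`, audit sheets D-AUDIT-lw16-r1 §2.3 (i) / -r2 §4).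
-/

noncomputable section

open scoped Classical
open WeierstrassCurve Field

universe u

namespace Summit.BirchSwinnertonDyer.Rank1Residual.LW16.IsogenyEdge

variable {F : Type u} [Field F] {W W' : WeierstrassCurve F}

/-- A rational point, seen in `E(F̄)`, lies in the `Γ_F`-fixed subgroup. Silverman, *AEC*, VIII.§1
(`smul_toGeomPoints`). [folklore] -/
theorem toGeomPoints_mem_fixedPoints_addSubgroup (P : W.toAffine.Point) :
    toGeomPoints W P ∈ FixedPoints.addSubgroup (absoluteGaloisGroup F) (geomPoints W) :=
  (FixedPoints.mem_addSubgroup _ _ _).mpr fun σ ↦ smul_toGeomPoints W σ P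

/-- **`E(F) → E(F̄)^{Γ_F}` is a bijective homomorphism** for `F` perfect (injective:
`toGeomPoints_injective`; onto: Galois descent `exists_toGeomPoints_eq_of_forall_smul_eq`).
Silverman, *AEC*, VIII.§1. [folklore] -/
theorem bijective_codRestrict_toGeomPoints [PerfectField F] :
    Function.Bijective ((toGeomPoints W).codRestrict
      (FixedPoints.addSubgroup (absoluteGaloisGroup F) (geomPoints W))
      (toGeomPoints_mem_fixedPoints_addSubgroup (W := W))) := by
  refine ⟨fun P Q h ↦ toGeomPoints_injective W (congrArg Subtype.val h), fun y ↦ ?_⟩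
  obtain ⟨P, hP⟩ := exists_toGeomPoints_eq_of_forall_smul_eq W
    ((FixedPoints.mem_addSubgroup _ _ _).mp y.2)
  exact ⟨P, Subtype.ext hP⟩

/-- **The index is unchanged**: for `P ∈ E(F)` and `y = ` its image in `E(F̄)^{Γ_F}`,
`[E(F̄)^{Γ_F} : ℤy] = [E(F) : ℤP]` (transport along the bijective homomorphism above).
[folklore] -/
theorem index_zmultiples_toGeomPoints [PerfectField F] (P : W.toAffine.Point) :
    (AddSubgroup.zmultiples (⟨toGeomPoints W P, toGeomPoints_mem_fixedPoints_addSubgroup P⟩ :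
      FixedPoints.addSubgroup (absoluteGaloisGroup F) (geomPoints W))).index =
      (AddSubgroup.zmultiples P).index := by
  set f := (toGeomPoints W).codRestrict
      (FixedPoints.addSubgroup (absoluteGaloisGroup F) (geomPoints W))
      (toGeomPoints_mem_fixedPoints_addSubgroup (W := W)) with hf
  have hbij := bijective_codRestrict_toGeomPoints (W := W)
  have hmap : (AddSubgroup.zmultiples P).map f =
      AddSubgroup.zmultiples (⟨toGeomPoints W P, toGeomPoints_mem_fixedPoints_addSubgroup P⟩ :
        FixedPoints.addSubgroup (absoluteGaloisGroup F) (geomPoints W)) := by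
    rw [AddMonoidHom.map_zmultiples]; rfl
  rw [← hmap]
  exact AddSubgroup.index_map_eq _ hbij.2 (by
    rw [(AddMonoidHom.ker_eq_bot_iff f).mpr hbij.1]; exact bot_le)

/-- **Infinite order is unchanged**: `P ∈ E(F)` has infinite order iff its image in
`E(F̄)^{Γ_F}` has. [folklore] -/
theorem isOfFinAddOrder_toGeomPoints_iff (P : W.toAffine.Point) :
    IsOfFinAddOrder (⟨toGeomPoints W P, toGeomPoints_mem_fixedPoints_addSubgroup P⟩ :
      FixedPoints.addSubgroup (absoluteGaloisGroup F) (geomPoints W)) ↔ IsOfFinAddOrder P := by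
  rw [← (toGeomPoints_injective W).isOfFinAddOrder_iff (x := P),
    ← (AddSubgroupClass.subtype_injective
      (FixedPoints.addSubgroup (absoluteGaloisGroup F) (geomPoints W))).isOfFinAddOrder_iff]
  rfl

variable [W.IsElliptic] [W'.IsElliptic]

/-- **The edge dichotomy with `F`-rational data** (the binders' currency). Let `φ : E → E'`,
`ψ : E' → E` be isogenies of elliptic curves over a perfect field `F` with `ψ (φ Q) = p • Q`
(`p` prime), `P ∈ E(F)` of infinite order with `p ∤ [E(F) : ℤP]` (the `m₀ = 0` certificate of the
Kolyvagin binders, `P = y_K`), and `P' ∈ E'(F)` with `p ∤ [E'(F) : ℤP']`. Then EXACTLY ONE of: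
(A) `P` has a `p`-th root `Q ∈ E(F̄)` with `σQ − Q ∈ ker φ` for every `σ ∈ Γ_F` — the Kummer
extension `F(E[p], P/p)/F(E[p])` has group inside `ker φ`, so the conclusion
`Gal(L(P/p)/L) ≅ E_p` of Gross 1991 Prop. 9.3 for `S = ⟨δP⟩` is false (Matar–Nekovář 2019
Prop. 6.4 (C5)); (B) `E'(F) = ℤφ(P) + pE'(F)` (stated in `E'(F̄)` over `F`-rational points).
From `exists_root_xor_generates_of_not_dvd_index` by transport along `toGeomPoints`. [folklore] -/
theorem exists_root_xor_generates_of_not_dvd_index_point [PerfectField F] (φ : Isogeny W W')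
    (ψ : Isogeny W' W) {p : ℕ} (hp : p.Prime) (hψφ : ∀ Q, ψ (φ Q) = (p : ℤ) • Q)
    (P : W.toAffine.Point) (hP : ¬ IsOfFinAddOrder P)
    (hidx : ¬ p ∣ (AddSubgroup.zmultiples P).index)
    (P' : W'.toAffine.Point) (hidx' : ¬ p ∣ (AddSubgroup.zmultiples P').index) :
    Xor (∃ Q : geomPoints W, (p : ℤ) • Q = toGeomPoints W P ∧
        ∀ σ : absoluteGaloisGroup F, σ • Q - Q ∈ φ.toAddMonoidHom.ker)
      (∀ a' : W'.toAffine.Point, ∃ (n : ℤ) (b' : W'.toAffine.Point),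
        toGeomPoints W' a' = n • φ (toGeomPoints W P) + (p : ℤ) • toGeomPoints W' b') := by
  have h := exists_root_xor_generates_of_not_dvd_index φ ψ hp hψφ
    ⟨toGeomPoints W P, toGeomPoints_mem_fixedPoints_addSubgroup P⟩
    (by rwa [isOfFinAddOrder_toGeomPoints_iff]) (by rwa [index_zmultiples_toGeomPoints])
    ⟨toGeomPoints W' P', toGeomPoints_mem_fixedPoints_addSubgroup P'⟩
    (by rwa [index_zmultiples_toGeomPoints])
  -- Case B over fixed geometric points ↔ Case B over `F`-points (Galois descent)
  have hB : (∀ a' ∈ FixedPoints.addSubgroup (absoluteGaloisGroup F) (geomPoints W'),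
        ∃ n : ℤ, ∃ b' ∈ FixedPoints.addSubgroup (absoluteGaloisGroup F) (geomPoints W'),
          a' = n • φ (toGeomPoints W P) + (p : ℤ) • b') ↔
      ∀ a' : W'.toAffine.Point, ∃ (n : ℤ) (b' : W'.toAffine.Point),
        toGeomPoints W' a' = n • φ (toGeomPoints W P) + (p : ℤ) • toGeomPoints W' b' := by
    constructor
    · intro H a'
      obtain ⟨n, b', hb', h'⟩ := H _ (toGeomPoints_mem_fixedPoints_addSubgroup a')
      obtain ⟨b₀, rfl⟩ := exists_toGeomPoints_eq_of_forall_smul_eq W'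
        ((FixedPoints.mem_addSubgroup _ _ _).mp hb')
      exact ⟨n, b₀, h'⟩
    · intro H a' ha'
      obtain ⟨a₀, rfl⟩ := exists_toGeomPoints_eq_of_forall_smul_eq W'
        ((FixedPoints.mem_addSubgroup _ _ _).mp ha')
      obtain ⟨n, b₀, h'⟩ := H a₀
      exact ⟨n, toGeomPoints W' b₀, toGeomPoints_mem_fixedPoints_addSubgroup b₀, h'⟩
  rcases h with ⟨hA, hnB⟩ | ⟨hB', hnA⟩
  · exact Or.inl ⟨hA, fun H ↦ hnB (hB.mpr H)⟩
  · exact Or.inr ⟨hB.mp hB', hnA⟩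

/-- **The image point always degenerates** — `F`-rational form of
`exists_root_map_forall_smul_sub_mem_ker`: for `P ∈ E(F)` and `φ ∘ ψ = [m]`, `φ(P)` has an
`m`-th root `Q' ∈ E'(F̄)` with `σQ' − Q' ∈ ker ψ` for all `σ ∈ Γ_F` (so in Case B of the
dichotomy it is the certificate point `φ(P)` of `E'` whose Kummer extension degenerates).
[folklore] -/
theorem exists_root_map_toGeomPoints (φ : Isogeny W W') (ψ : Isogeny W' W) (m : ℤ)
    (hφψ : ∀ Q', φ (ψ Q') = m • Q') (P : W.toAffine.Point) :
    ∃ Q' : geomPoints W', m • Q' = φ (toGeomPoints W P) ∧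
      ∀ σ : absoluteGaloisGroup F, σ • Q' - Q' ∈ ψ.toAddMonoidHom.ker :=
  exists_root_map_forall_smul_sub_mem_ker φ ψ m hφψ (toGeomPoints_mem_fixedPoints_addSubgroup P)

/-! ### Case B in index currency for `F`-rational points -/

omit [W.IsElliptic] [W'.IsElliptic] in
/-- **`φ(P)` is an `F`-rational point of `E'`**: for `P ∈ E(F)` there is a (unique, by
`toGeomPoints_injective`) `P₁ ∈ E'(F)` with `toGeomPoints W' P₁ = φ (toGeomPoints W P)` (the
isogeny is defined over `F`; Galois descent). Silverman, *AEC*, III.4, VIII.§1. [folklore] -/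
theorem exists_point_toGeomPoints_eq_map [PerfectField F] (φ : Isogeny W W')
    (P : W.toAffine.Point) :
    ∃ P₁ : W'.toAffine.Point, toGeomPoints W' P₁ = φ (toGeomPoints W P) :=
  exists_toGeomPoints_eq_of_forall_smul_eq W'
    ((FixedPoints.mem_addSubgroup _ _ _).mp
      (map_mem_fixedPoints φ (toGeomPoints_mem_fixedPoints_addSubgroup P)))

omit [W.IsElliptic] [W'.IsElliptic] in
/-- **Case B ⇒ `E'` passes the certificate with the point `φ(P)`.** If `P₁ ∈ E'(F)` is the
rational point with `toGeomPoints W' P₁ = φ (toGeomPoints W P)`, `[E'(F) : ℤP₁]` is finite, and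
`E'(F) = ℤφ(P) + pE'(F)` (Case B of `exists_root_xor_generates_of_not_dvd_index_point`), then
`p ∤ [E'(F) : ℤP₁]` (`not_dvd_index_of_generates`). Along a `p`-isogeny edge the index of a
certificate point thus either stays prime to `p` on the image (Case B) or acquires the factor
`p` (Case A, `φ(P) ∈ pE'(F)`; sheet D-AUDIT-lw16-r1 §2.3 (i), §4). [folklore] -/
theorem not_dvd_index_of_generates_point {p : ℕ} (hp : p.Prime) (φ : Isogeny W W')
    (P : W.toAffine.Point) (P₁ : W'.toAffine.Point)
    (hP₁ : toGeomPoints W' P₁ = φ (toGeomPoints W P))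
    (hfin : (AddSubgroup.zmultiples P₁).index ≠ 0)
    (hB : ∀ a' : W'.toAffine.Point, ∃ (n : ℤ) (b' : W'.toAffine.Point),
      toGeomPoints W' a' = n • φ (toGeomPoints W P) + (p : ℤ) • toGeomPoints W' b') :
    ¬ p ∣ (AddSubgroup.zmultiples P₁).index := by
  refine not_dvd_index_of_generates hp hfin fun a' ↦ ?_
  obtain ⟨n, b', h⟩ := hB a'
  refine ⟨n, b', toGeomPoints_injective W' ?_⟩
  rw [map_add, map_zsmul, map_zsmul, hP₁, h]

end Summit.BirchSwinnertonDyer.Rank1Residual.LW16.IsogenyEdge
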